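import Summits.CriticalPhenomena.PercolationContinuityZ3.Theorems.PercNearOneGluingNoHeavyLowerTailCovTauHtwWorld
import HarnessLib

/-!
# Crux `NoHeavyLowerTail` (stmt-CriticalPhenomena-4575): (Htw) in `delE` form for a GENERAL marker set

Support file (`--supports stmt-CriticalPhenomena-4575`, prover prim-hp-4 gen 11).  No named facts, no sorries, no
`Prop` definitions.  Companion of `…CovTauHtwWorld.lean` (which has the pair case `CovTau.htw_delE`, `S = {x, d}`, =
the hypothesis `HTW` of the level-one CSH cell): the same `delE`/`covW` statement for an arbitrary marker set `S ∋ x`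
with `v ∉ S ∪ Y` — the shape needed by the general-`k` cells of prim-hp-8's conditioned slack hierarchy
(PROOF-S5-ALL-R.md §3, Lemma H with `S = {x} ∪ D`, all decoys), socket piece P4 output for `…CSHMain` (prim-ineq-prove-1).
[cite: VandenbergHaggstromKahn2005, Thm. 1.1 (pp. 3–5), Thm. 1.4 (p. 7)] [cite: Gladkov2024, Thm. 3.2 (p. 4)]
[cite: KozmaNitzan2024, Conj. 1 (p. 3)]
-/

noncomputable section

namespace Summit.CriticalPhenomena.PercolationContinuityZ3.Theorems.CovTau

open Set MeasureTheory Literature.Probability.LatticeModels Literature.Probability.Percolation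
open Literature.Probability.Percolation.BHK2006
open Literature.Probability.Percolation.DecisionTree (ind ind_of_mem ind_of_not_mem ind_nonneg)
open HullPort (delE cut avoidEv)
open CSH (wmeanOff wcovOff)
open scoped Classical

variable {V : Type*} [Fintype V]

/-- **(Htw) in `delE`/`covW` form for a GENERAL marker set `S`** (`x ∈ S`, `v ∉ S ∪ Y`; the general-`k` cells use
`S = {x} ∪ D`): for weights `q < 1`, threshold `p = μ(v ↔ o | v ↮ S ∪ Y)` given by its defining equation, and every
monotone edge-cluster functional `g ≥ 0`,
`0 ≤ Σ_ω q(ω) 1{x ↮ Y}(ω) · (p_ω − p) · Cov_{G − cut Y ω}(g(C_x), 1{v ↔ S})`, `p_ω = μ_{G−cut Y ω}(v↔o, v↮S)/μ_{G−cut Y ω}(v↮S)`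
(PROOF-S5-ALL-R (K9), display (Htw), same conventions as `CovTau.htw_delE`).
[cite: VandenbergHaggstromKahn2005, Thm. 1.1 (pp. 3–5), Thm. 1.4 (p. 7)] [cite: Gladkov2024, Thm. 3.2 (p. 4)] -/
theorem htw_delE_set (q : Sym2 V → unitInterval) (hq : ∀ e, (q e : ℝ) < 1) {x v : V} {S : Set V} (hxS : x ∈ S)
    (hvS : v ∉ S) (o : V) (Y : Set V) (hvY : v ∉ Y) (p : ℝ)
    (hp : p * (prodBernoulli q).real
        {ω : BondConfig V | ∀ t ∈ S ∪ Y, ¬ (openGraph ω).Reachable v t} =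
      (prodBernoulli q).real
        ({ω : BondConfig V | ∀ t ∈ S ∪ Y, ¬ (openGraph ω).Reachable v t} ∩ openConn v o))
    (g : Set (Sym2 V) → ℝ) (hg : Monotone g) (hg0 : ∀ C, 0 ≤ g C) :
    0 ≤ ∑ ω, weight (fun e => (q e : ℝ)) ω * (ind (avoidEv x Y) ω *
        ((delE (fun e => (q e : ℝ)) (cut Y ω)
              (ind ({ζ : BondConfig V | ∀ s ∈ S, ¬ (openGraph ζ).Reachable s v} ∩ openConn o v)) /
            delE (fun e => (q e : ℝ)) (cut Y ω)
              (ind {ζ : BondConfig V | ∀ s ∈ S, ¬ (openGraph ζ).Reachable s v}) - p) *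
          HullPort.covW (fun e => (q e : ℝ)) Y (fun η => g (openEdgeCluster η x))
            (ind {ζ : BondConfig V | ∃ s ∈ S, (openGraph ζ).Reachable s v}) ω)) := by
  set ŵ : Sym2 V → ℝ := fun e => (q e : ℝ) with hŵ
  have hw0 : ∀ e, 0 ≤ ŵ e := fun e => (q e).2.1
  have hw1 : ∀ e, ŵ e ≤ 1 := fun e => (q e).2.2
  have hq' : ∀ e, ŵ e < 1 := hq
  have hm : ∑ ω, weight ŵ ω = 1 := sum_weight_coe_eq_one q
  have h := htw_world ŵ hw0 hw1 hm hxS hvS o hg hg0 Y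
  have hA : avoidEv v S = {ζ : Set (Sym2 V) | ∀ s ∈ S, ¬ (openGraph ζ).Reachable s v} := avoidEv_eq_setOf_symm v _
  have hO : (openConn v o : Set (BondConfig V)) = openConn o v := KNPreFKG.openConn_symm v o
  simp only [hA, hO, wmeanOff_eq_delE, wcovOff_eq_covW] at h
  -- the two global masses
  set α : ℝ := ∑ ω, weight ŵ ω * ind (avoidEv v (S ∪ Y)) ω with hαdef
  set β : ℝ := ∑ ω, weight ŵ ω * ind (avoidEv v (S ∪ Y) ∩ (openConn o v : Set (BondConfig V))) ω with hβdef
  have hαμ : α = (prodBernoulli q).real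
      {ω : BondConfig V | ∀ t ∈ S ∪ Y, ¬ (openGraph ω).Reachable v t} := sum_weight_ind q _
  have hβμ : β = (prodBernoulli q).real
      ({ω : BondConfig V | ∀ t ∈ S ∪ Y, ¬ (openGraph ω).Reachable v t} ∩ openConn v o) := by
    rw [hβdef, ← hO]; exact sum_weight_ind q _
  have hpα : p * α = β := by rw [hαμ, hβμ]; exact hp
  have hαpos : 0 < α := by
    have hmem : (∅ : Set (Sym2 V)) ∈ avoidEv v (S ∪ Y) := by
      intro t ht hr
      rw [HullPort.reachable_empty_iff] at hr
      subst hr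
      rcases ht with ht | ht
      · exact hvS ht
      · exact hvY ht
    calc (0 : ℝ) < weight ŵ (∅ : Set (Sym2 V)) * ind (avoidEv v (S ∪ Y)) ∅ := by
          rw [ind_of_mem hmem, mul_one]; exact HullPort.weight_empty_pos ŵ hq'
      _ ≤ α := Finset.single_le_sum (f := fun ω => weight ŵ ω * ind (avoidEv v (S ∪ Y)) ω)
          (fun ω _ => mul_nonneg (weight_nonneg hw0 hw1 ω) (ind_nonneg _ _)) (Finset.mem_univ _)
  -- the two world sums
  set A : ℝ := ∑ ω, weight ŵ ω * (ind (avoidEv x Y) ω *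
      HullPort.covW ŵ Y (fun η => g (openEdgeCluster η x))
        (ind {ζ : BondConfig V | ∃ s ∈ S, (openGraph ζ).Reachable s v}) ω) with hAdef
  set B : ℝ := ∑ ω, weight ŵ ω * (ind (avoidEv x Y) ω *
      (delE ŵ (cut Y ω) (ind ({ζ : BondConfig V | ∀ s ∈ S, ¬ (openGraph ζ).Reachable s v} ∩ openConn o v)) /
          delE ŵ (cut Y ω) (ind {ζ : BondConfig V | ∀ s ∈ S, ¬ (openGraph ζ).Reachable s v}) *
        HullPort.covW ŵ Y (fun η => g (openEdgeCluster η x))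
          (ind {ζ : BondConfig V | ∃ s ∈ S, (openGraph ζ).Reachable s v}) ω)) with hBdef
  change β * A ≤ α * B at h
  have e : ∀ ω : Set (Sym2 V),
      weight ŵ ω * (ind (avoidEv x Y) ω *
        ((delE ŵ (cut Y ω) (ind ({ζ : BondConfig V | ∀ s ∈ S, ¬ (openGraph ζ).Reachable s v} ∩ openConn o v)) /
            delE ŵ (cut Y ω) (ind {ζ : BondConfig V | ∀ s ∈ S, ¬ (openGraph ζ).Reachable s v}) - p) *
          HullPort.covW ŵ Y (fun η => g (openEdgeCluster η x))
            (ind {ζ : BondConfig V | ∃ s ∈ S, (openGraph ζ).Reachable s v}) ω)) =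
      weight ŵ ω * (ind (avoidEv x Y) ω *
        (delE ŵ (cut Y ω) (ind ({ζ : BondConfig V | ∀ s ∈ S, ¬ (openGraph ζ).Reachable s v} ∩ openConn o v)) /
            delE ŵ (cut Y ω) (ind {ζ : BondConfig V | ∀ s ∈ S, ¬ (openGraph ζ).Reachable s v}) *
          HullPort.covW ŵ Y (fun η => g (openEdgeCluster η x))
            (ind {ζ : BondConfig V | ∃ s ∈ S, (openGraph ζ).Reachable s v}) ω)) -
      p * (weight ŵ ω * (ind (avoidEv x Y) ω *
        HullPort.covW ŵ Y (fun η => g (openEdgeCluster η x))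
          (ind {ζ : BondConfig V | ∃ s ∈ S, (openGraph ζ).Reachable s v}) ω)) := fun ω => by ring
  rw [Finset.sum_congr rfl fun ω _ => e ω, Finset.sum_sub_distrib, ← Finset.mul_sum]
  change 0 ≤ B - p * A
  have h' : α * (p * A) ≤ α * B := by
    calc α * (p * A) = β * A := by rw [← hpα]; ring
      _ ≤ α * B := h
  exact sub_nonneg.2 (le_of_mul_le_mul_left h' hαpos)

end Summit.CriticalPhenomena.PercolationContinuityZ3.Theorems.CovTau
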